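import Literature.ComputerArithmetic.Shewchuk1997.Compress
import Summits.Ventures.CertifiedArithmetic.Expansions.WeakExpansion
import Mathlib.Tactic.Linarith
import Mathlib.Tactic.Positivity
import Mathlib.Tactic.Ring
import Mathlib.Tactic.NormNum

/-!
# COMPRESS under any tie rule: the adjacency invariant of the upward sweep (new work, p ≥ 4)

New work of the certified-arithmetic venture (ENGINES group: shared numerical engines serving
client cells; rigour lives in the verifiers; every published number belongs to a client cell's
ledger, not to the engines group).  Theorem 23 of [Shewchuk1997, §2.7] makes `h = COMPRESS(e)`
nonoverlapping under every round-to-nearest and NONADJACENT under round-to-even; the venture's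
`CompressAdjacentTiesAway` shows that under ties-to-away an adjacent pair does occur
(`⟨2^e₀, 2^p·2^e₀⟩ ↦ ⟨−2^e₀, (2^p+2)·2^e₀⟩`).  This file and its sequel prove what survives
for EVERY round-to-nearest map at precision `p ≥ 4` (components by increasing magnitude):
(i) no component of `COMPRESS(e)` is adjacent to both neighbours — of three consecutive
components `a, b, c`, `a` lies 2-below `b` or `b` lies 2-below `c` (`NoDoubleAdj`); (ii) the
LOWER member of an adjacent consecutive pair is a one-bit number `±2^k` (`LowOneBit`) — the two
relaxations of nonadjacency in the venture's class W of weakly nonoverlapping expansions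
(`WeakExpansion.lean`).  THIS FILE carries the invariant `AdjInv` of the upward sweep
(Lines 10–16) through one FAST-TWO-SUM step, beside the tree's `UpInv 1` of Theorem 23
(`AdjInv.absorb`, `AdjInv.emit`); the sequel runs the sweep and COMPRESS.

MECHANISM.  When a roundoff `q_A = (g_A + Q_A) − x_A ≠ 0` is emitted, the carry
`x_A = fl(g_A + Q_A)` is NORMAL on the grid `2^u := ulp(g_A + Q_A)` (`|x_A| ≥ 2^(p−1)·2^u`,
`2|q_A| ≤ 2^u`) and every later carry and roundoff stays on that grid (`AdjInv.hd`); so the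
component placed above `q_A` is 2-above it unless `|q_A| = 2^(u−1)` — clause (ii),
`lowOneBit_of_onGrid`.  Clause (i): if the next emitted roundoff `q_B` is adjacent to `q_A`
then `q_B ∉ 2^(u+1)ℤ`, and `2|q_B| = ulp x_B` would give `|q_B| = 2^u`,
`|x_B| < 2^p·2^(u+1)`, against `|g_B| ≥ 2^(p−1) ulp g_B ≥ 2^(p−1)|Q_B| ≥ 2^(2p−2)·2^u` and
`|x_B| ≥ |g_B| − |Q_B| − |q_B|` (`below_two_emit_of_adjacent`, the one place `p ≥ 4` is
used): `q_B` lies 2-below its carry, a relation the exact steps preserve and the next emission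
inherits (`AdjInv.flag`).  HONEST FRAMING: nothing here is claimed by the paper; for `p = 2`
the upward-sweep invariants alone do NOT give (i) (from the unreachable sweep state `Q = 1`,
`g = ⟨4, −16⟩` ties-to-away emits `⟨−1, 2, −12⟩`), and `p = 3` is not treated.
-/

namespace Summit.Ventures.CertifiedArithmetic.Expansions

open Literature.ComputerArithmetic.JeannerodRump2018
open Literature.ComputerArithmetic.BoldoJeannerodMelquiondMuller2023 hiding twoSum twoSum_fst
open Literature.ComputerArithmetic.Shewchuk1997

variable {p : ℕ} {emin : ℤ} {fl : ℚ → ℚ}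

/-! ### The window and pair predicates -/

/-- NO DOUBLE ADJACENCY, components in DEcreasing magnitude (the order in which the upward
sweep accumulates them): every window of three consecutive components `a, b, c` satisfies the
triple condition `NoDouble c b a` of `WeakExpansion.lean` (`c` lies 2-below `b` or `b` lies
2-below `a`). [cite: Shewchuk1997, §2.1 p. 309 (adjacent), §2.4] -/
def NoDoubleAdjDesc (l : List ℚ) : Prop :=
  ∀ (t₁ : List ℚ) (a b c : ℚ) (t₂ : List ℚ), l = t₁ ++ a :: b :: c :: t₂ → NoDouble c b a

/-- NO DOUBLE ADJACENCY, components in INcreasing magnitude (the output order of COMPRESS):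
every window of three consecutive components `a, b, c` satisfies `NoDouble a b c` (`a` lies
2-below `b` or `b` lies 2-below `c`) — no component is adjacent to both neighbours (`x`
nonoverlapping `y` is adjacent to it iff `¬ Below 2 x y`). [cite: Shewchuk1997, §2.1, §2.4] -/
def NoDoubleAdj (l : List ℚ) : Prop :=
  ∀ (t₁ : List ℚ) (a b c : ℚ) (t₂ : List ℚ), l = t₁ ++ a :: b :: c :: t₂ → NoDouble a b c

/-- LOW ONE-BIT pair condition (`a` the less significant component): `a` lies 2-below `b`, or
`a` is a one-bit number `|a| = 2^k`. [cite: Shewchuk1997, §2.4 (strongly nonoverlapping)] -/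
def LowOneBit (a b : ℚ) : Prop :=
  Below 2 a b ∨ ∃ k : ℤ, |a| = (2 : ℚ) ^ k

/-- Lists with fewer than three components have no window. [cite: Shewchuk1997, §2.4] -/
theorem noDoubleAdjDesc_of_length_lt {l : List ℚ} (hl : l.length < 3) : NoDoubleAdjDesc l := by
  intro t₁ a b c t₂ h
  have := congrArg List.length h
  simp only [List.length_append, List.length_cons] at this
  omega

/-- Extending a window-good list at the head. [cite: Shewchuk1997, §2.4] -/
theorem NoDoubleAdjDesc.cons {x : ℚ} {l : List ℚ} (h : NoDoubleAdjDesc l)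
    (hw : ∀ (b c : ℚ) (t : List ℚ), l = b :: c :: t → NoDouble c b x) :
    NoDoubleAdjDesc (x :: l) := by
  intro t₁ a b c t₂ heq
  cases t₁ with
  | nil =>
    simp only [List.nil_append, List.cons.injEq] at heq
    obtain ⟨rfl, rfl⟩ := heq
    exact hw b c t₂ rfl
  | cons y t₁ =>
    simp only [List.cons_append, List.cons.injEq] at heq
    exact h t₁ a b c t₂ heq.2

/-- Reversal turns the decreasing form into the increasing one. [cite: Shewchuk1997, §2.4] -/
theorem NoDoubleAdjDesc.reverse {l : List ℚ} (h : NoDoubleAdjDesc l) :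
    NoDoubleAdj l.reverse := by
  intro t₁ a b c t₂ heq
  have h' : l = t₂.reverse ++ c :: b :: a :: t₁.reverse := by
    simpa using congrArg List.reverse heq
  exact h _ _ _ _ _ h'

/-! ### Grids in one FAST-TWO-SUM step of the upward sweep -/

/-- A carry normal on the grid `2^u` is at least `2^u`. [cite: BoldoEtAl2023, §2.1] -/
theorem two_zpow_le_of_normal {u : ℤ} {Q : ℚ} (h : (2 : ℚ) ^ u * 2 ^ (p - 1) ≤ |Q|) :
    (2 : ℚ) ^ u ≤ |Q| :=
  le_trans (le_mul_of_one_le_right (zpow_nonneg (by norm_num) u) (one_le_pow₀ (by norm_num))) h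

/-- The dichotomy behind clause (ii): if `x` is on the grid `2^u` and `2|r| ≤ 2^u` then `r` lies
2-below `x` or `|r| = 2^(u−1)`. [cite: Shewchuk1997, §2.1 p. 309] -/
theorem lowOneBit_of_onGrid {r x : ℚ} {u : ℤ} (hx : OnGrid u x) (hr : 2 * |r| ≤ (2 : ℚ) ^ u) :
    LowOneBit r x := by
  rcases hr.lt_or_eq with h | h
  · exact Or.inl ⟨u, hx, h⟩
  · exact Or.inr ⟨u - 1, by rw [zpow_sub_one₀ two_ne_zero]; linarith⟩

/-- A number lying 2-below a nonzero float `Q` does so on a grid `2^s` with `emin ≤ s`,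
`OnGrid s Q`, `2|r| < 2^s` and `2^s ≤ |Q|`. [cite: Shewchuk1997, §2.1 p. 309] -/
theorem below_two_grid {r Q : ℚ} (h : Below 2 r Q) (hQ : IsFloat p emin Q) (hQ0 : Q ≠ 0) :
    ∃ s : ℤ, emin ≤ s ∧ OnGrid s Q ∧ 2 * |r| < (2 : ℚ) ^ s ∧ (2 : ℚ) ^ s ≤ |Q| := by
  obtain ⟨s, hs, hsQ, hrs⟩ := h.normalize hQ
  exact ⟨s, hs, hsQ, hrs, hsQ.two_zpow_le_abs hQ0⟩

/-- In a step `(x, q) = FAST-TWO-SUM(g, Q)` of the upward sweep (`g` a float, `|Q| ≤ ulp g`) a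
grid `2^s ≤ |Q|` (`emin ≤ s`) carrying `Q` carries `g`, hence `x` and `q` (the tree's
`onGrid_fastTwoSum`). [cite: Shewchuk1997, Thm 23 p. 333 (proof)] -/
theorem onGrid_upStep (hp : 1 ≤ p) (hfl : IsRoundNearest p emin fl) {g Q : ℚ}
    (hg : IsFloat p emin g) (hQg : |Q| ≤ ulp p emin g) {s : ℤ} (hs : emin ≤ s)
    (hsQ : OnGrid s Q) (h2s : (2 : ℚ) ^ s ≤ |Q|) :
    OnGrid s (fastTwoSum fl g Q).1 ∧ OnGrid s (fastTwoSum fl g Q).2 :=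
  onGrid_fastTwoSum hp hfl hs (onGrid_of_two_zpow_le_ulp hg (h2s.trans hQg)) hsQ

/-! ### The key step: after an adjacent pair the new roundoff lies 2-below its carry -/

/-- **KEY STEP** (`p ≥ 4`).  In a step `(x, q) = FAST-TWO-SUM(g, Q)` of the upward sweep with
`q ≠ 0` (`g` a float, `|g| ≥ 2^(emin+p)`, `|Q| ≤ ulp g`), suppose the carry `Q` is normal on a
grid `2^u` (`OnGrid u Q`, `2^(p−1)·2^u ≤ |Q|`) below which the previous roundoff `r` sits
(`2|r| ≤ 2^u`).  If `q` is adjacent to `r` (`¬ Below 2 r q`) then `q` lies 2-below `x`: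
`2|r| = 2^u` and `q ∉ 2^(u+1)ℤ`; if `2|q| = ulp x` then `|q| = 2^u`, `ulp x = 2^(u+1)`,
`|x| < 2^p·2^(u+1)`, against `|x| ≥ |g| − |Q| − |q| ≥ (2^(2p−2) − 2^(p−1) − 1)·2^u`.
[cite: Shewchuk1997, Thm 23 p. 333; BoldoEtAl2023, §2.1 (ulp)] -/
theorem below_two_emit_of_adjacent (hp : 4 ≤ p) (hfl : IsRoundNearest p emin fl) {r Q g : ℚ}
    {u : ℤ} (hu : emin ≤ u) (huQ : OnGrid u Q) (hr : 2 * |r| ≤ (2 : ℚ) ^ u)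
    (hQbig : (2 : ℚ) ^ u * 2 ^ (p - 1) ≤ |Q|) (hQ : IsFloat p emin Q) (hg : IsFloat p emin g)
    (hgbig : (2 : ℚ) ^ (emin + p) ≤ |g|) (hQg : |Q| ≤ ulp p emin g)
    (hq : (fastTwoSum fl g Q).2 ≠ 0) (hadj : ¬ Below 2 r (fastTwoSum fl g Q).2) :
    Below 2 (fastTwoSum fl g Q).2 (fastTwoSum fl g Q).1 := by
  have hp1 : 1 ≤ p := by omega
  have hA : (0 : ℚ) < 2 ^ u := zpow_pos (by norm_num) _
  have hP8 : (8 : ℚ) ≤ 2 ^ (p - 1) :=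
    calc (8 : ℚ) = 2 ^ 3 := by norm_num
      _ ≤ 2 ^ (p - 1) := pow_le_pow_right₀ (by norm_num) (by omega)
  have hg0 : g ≠ 0 := abs_pos.mp ((zpow_pos two_pos _).trans_le hgbig)
  have hQleg : |Q| ≤ |g| := hQg.trans (ulp_le_abs_of_isFloat hg hg0)
  obtain ⟨h1, -, h2, h4⟩ := fastTwoSum_exact hp1 hfl hg hQ hQleg
  have hF12 := isFloat_fastTwoSum hfl g Q
  obtain ⟨-, hsq⟩ := onGrid_upStep hp1 hfl hg hQg hu huQ (two_zpow_le_of_normal hQbig)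
  have hq_half : |(fastTwoSum fl g Q).2| ≤ ulp p emin (g + Q) / 2 := by
    rw [h2]; exact abs_sub_fl_le_half_ulp hp1 hfl _
  have hulp_t : ulp p emin (g + Q) ≤ ulp p emin (fastTwoSum fl g Q).1 := by
    rw [h1]; exact ulp_le_ulp_fl hp1 hfl _
  generalize hQn : (fastTwoSum fl g Q).1 = Qn at *
  generalize hqn : (fastTwoSum fl g Q).2 = q at *
  -- adjacency to `r`: `2|r| = 2^u` and `q` is not on the grid `2^(u+1)`
  have hr_eq : 2 * |r| = (2 : ℚ) ^ u := by
    by_contra hne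
    exact hadj ⟨u, hsq, lt_of_le_of_ne hr hne⟩
  have hnot : ¬ OnGrid (u + 1) q := fun h' =>
    hadj ⟨u + 1, h', by rw [hr_eq, zpow_add_one₀ two_ne_zero]; linarith⟩
  -- the grid of the new carry
  obtain ⟨w, -, hW⟩ := exists_ulp_eq_two_zpow (p := p) (emin := emin) Qn
  have hwQn : OnGrid w Qn := by
    obtain ⟨K, hK⟩ := exists_eq_int_mul_ulp_of_isFloat (p := p) (emin := emin) hF12.1
    exact ⟨K, by rw [← hW]; exact hK⟩
  refine ⟨w, hwQn, lt_of_le_of_ne (by rw [← hW]; linarith) fun heq => ?_⟩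
  -- suppose `2|q| = 2^w = ulp Qn`: then `|q| = 2^(w-1)` and `w = u + 1`
  have hq_abs : |q| = (2 : ℚ) ^ (w - 1) := by
    rw [zpow_sub_one₀ two_ne_zero]; linarith
  have hq_grid : OnGrid (w - 1) q := by
    rcases (abs_eq (zpow_nonneg (by norm_num) (w - 1))).mp hq_abs with h | h
    · exact ⟨1, by rw [h]; simp⟩
    · exact ⟨-1, by rw [h]; simp⟩
  have hu_le : u ≤ w - 1 := by
    have := hsq.two_zpow_le_abs hq
    rw [hq_abs] at this
    exact (zpow_le_zpow_iff_right₀ (by norm_num : (1 : ℚ) < 2)).mp this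
  have hu_ge : w - 1 ≤ u := by
    by_contra hlt
    exact hnot (hq_grid.mono (by omega))
  have hwu : w = u + 1 := by omega
  -- magnitudes
  have hQn_lt : |Qn| < 2 ^ p * (2 : ℚ) ^ w := by rw [← hW]; exact abs_lt_two_pow_mul_ulp Qn
  have hn : (2 : ℚ) ^ (emin + p - 1) ≤ |g| :=
    le_trans (zpow_le_zpow_right₀ (by norm_num) (by omega)) hgbig
  have hU : ulp p emin g * 2 ^ (p - 1) ≤ |g| :=
    (le_div_iff₀ (by positivity)).mp (ulp_le_of_normal hp1 hn)
  have hQn_ge : |g| - |Q| - |q| ≤ |Qn| := by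
    have e : Qn = (g + Q) - q := by linarith [h4]
    rw [e]
    have i1 := abs_sub_abs_le_abs_sub (g + Q) q
    have i2 := abs_sub_abs_le_abs_sub g (-Q)
    rw [abs_neg, sub_neg_eq_add] at i2
    linarith
  have h2w : (2 : ℚ) ^ w = 2 ^ u * 2 := by rw [hwu, zpow_add_one₀ two_ne_zero]
  have h2p : (2 : ℚ) ^ p = 2 ^ (p - 1) * 2 := by
    rw [← pow_succ]; congr 1; omega
  rw [h2w, h2p] at hQn_lt
  rw [hq_abs, show w - 1 = u by omega] at hQn_ge
  have hUge : (2 : ℚ) ^ u * 2 ^ (p - 1) ≤ ulp p emin g := hQbig.trans hQg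
  nlinarith [mul_nonneg (sub_nonneg.mpr hUge) (by linarith : (0 : ℚ) ≤ 2 ^ (p - 1) - 1),
    mul_nonneg (mul_nonneg hA.le (sub_nonneg.mpr hP8)) (by positivity : (0 : ℚ) ≤ 2 ^ (p - 1) + 3)]

/-! ### The adjacency invariant of the upward sweep -/

/-- ADJACENCY INVARIANT of the upward sweep, carried next to the tree's `UpInv 1` (carry `Q`,
emitted roundoffs `rs`, newest first): no window of `rs` is doubly adjacent and every adjacent
pair has a one-bit lower member; the newest roundoff sits below a grid `2^u` on which the carry
is normal (`OnGrid u Q`, `2^(p−1)·2^u ≤ |Q|`, `2|r| ≤ 2^u` — `2^u = ulp` of the sum that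
produced it); and if the two newest roundoffs are adjacent, the newest lies 2-below the carry.
[cite: Shewchuk1997, Thm 23 p. 333; BoldoEtAl2023, §2.1] -/
structure AdjInv (p : ℕ) (emin : ℤ) (rs : List ℚ) (Q : ℚ) : Prop where
  /-- no window of `rs` is doubly adjacent -/
  win : NoDoubleAdjDesc rs
  /-- the lower member of an adjacent pair of `rs` is one-bit -/
  low : rs.IsChain (flip LowOneBit)
  /-- the newest roundoff sits below a grid on which the carry is normal -/
  hd : ∀ r ∈ rs.head?, ∃ u : ℤ, emin ≤ u ∧ OnGrid u Q ∧ 2 * |r| ≤ (2 : ℚ) ^ u ∧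
    (2 : ℚ) ^ u * 2 ^ (p - 1) ≤ |Q|
  /-- after an adjacent pair the newest roundoff lies 2-below the carry -/
  flag : ∀ (r₁ r₀ : ℚ) (t : List ℚ), rs = r₁ :: r₀ :: t → ¬ Below 2 r₀ r₁ → Below 2 r₁ Q

/-- The invariant holds trivially before the sweep. [cite: Shewchuk1997, Thm 23 p. 333] -/
theorem AdjInv.nil (Q : ℚ) : AdjInv p emin [] Q where
  win := noDoubleAdjDesc_of_length_lt (by simp)
  low := List.IsChain.nil
  hd := by simp
  flag := by simp

/-- EXACT STEP (`q = 0`, Lines 14–16 not executed): the carry becomes `x = g + Q`, which stays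
on every grid `2^s ≤ |Q|` carrying `Q`, and grows. [cite: Shewchuk1997, Thm 23 p. 333] -/
theorem AdjInv.absorb (hp : 2 ≤ p) (hfl : IsRoundNearest p emin fl) {rs : List ℚ} {Q g : ℚ}
    (ainv : AdjInv p emin rs Q) (inv : UpInv p emin 1 rs Q) (hg : IsFloat p emin g)
    (hgbig : (2 : ℚ) ^ (emin + p) ≤ |g|) (hQg : |Q| ≤ ulp p emin g)
    (hq : (fastTwoSum fl g Q).2 = 0) : AdjInv p emin rs (fastTwoSum fl g Q).1 := by
  have hp1 : 1 ≤ p := by omega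
  obtain ⟨-, -, hge⟩ := inv.absorb hp hfl hg hgbig hQg hq
  refine ⟨ainv.win, ainv.low, fun r hr => ?_, fun r₁ r₀ t heq hadj => ?_⟩
  · obtain ⟨u, hu, huQ, hr2, hQbig⟩ := ainv.hd r hr
    exact ⟨u, hu, (onGrid_upStep hp1 hfl hg hQg hu huQ (two_zpow_le_of_normal hQbig)).1, hr2,
      hQbig.trans hge⟩
  · obtain ⟨s, hs, hsQ, hrs, h2s⟩ :=
      below_two_grid (ainv.flag r₁ r₀ t heq hadj) inv.hQ (inv.hd r₁ (by rw [heq]; rfl)).2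
    exact ⟨s, (onGrid_upStep hp1 hfl hg hQg hs hsQ h2s).1, hrs⟩

/-- EMITTING STEP (`q ≠ 0`, `p ≥ 4`): the roundoff `q` is emitted and the carry becomes
`x = fl(g + Q)`.  The window invariant extends by the flag, the pair invariant by the old head
record (`lowOneBit_of_onGrid`), the new head record comes from `2^u = ulp(g + Q)` (`g + Q` is
normal: `|g + Q| ≥ |g| − ulp g ≥ 2^(emin+p−1)`), and the new flag is the key step
`below_two_emit_of_adjacent`. [cite: Shewchuk1997, Thm 23 p. 333; BoldoEtAl2023, §2.1] -/
theorem AdjInv.emit (hp : 4 ≤ p) (hfl : IsRoundNearest p emin fl) {rs : List ℚ} {Q g : ℚ}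
    (ainv : AdjInv p emin rs Q) (inv : UpInv p emin 1 rs Q) (hg : IsFloat p emin g)
    (hgbig : (2 : ℚ) ^ (emin + p) ≤ |g|) (hQg : |Q| ≤ ulp p emin g)
    (hq : (fastTwoSum fl g Q).2 ≠ 0) :
    AdjInv p emin ((fastTwoSum fl g Q).2 :: rs) (fastTwoSum fl g Q).1 := by
  have hp1 : 1 ≤ p := by omega
  have hg0 : g ≠ 0 := abs_pos.mp ((zpow_pos two_pos _).trans_le hgbig)
  have hQleg : |Q| ≤ |g| := hQg.trans (ulp_le_abs_of_isFloat hg hg0)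
  obtain ⟨h1, -, h2, -⟩ := fastTwoSum_exact hp1 hfl hg inv.hQ hQleg
  -- a `Below 2 · Q` relation of the current head transfers to the emitted roundoff
  have hconv : ∀ r ∈ rs.head?, Below 2 r Q → Below 2 r (fastTwoSum fl g Q).2 := by
    intro r hr hb
    obtain ⟨s, hs, hsQ, hrs, h2s⟩ := below_two_grid hb inv.hQ (inv.hd r hr).2
    exact ⟨s, (onGrid_upStep hp1 hfl hg hQg hs hsQ h2s).2, hrs⟩
  -- the new head record, on the grid `2^k = ulp(g + Q)`
  have hhd : ∃ u : ℤ, emin ≤ u ∧ OnGrid u (fastTwoSum fl g Q).1 ∧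
      2 * |(fastTwoSum fl g Q).2| ≤ (2 : ℚ) ^ u ∧
      (2 : ℚ) ^ u * 2 ^ (p - 1) ≤ |(fastTwoSum fl g Q).1| := by
    obtain ⟨k, hk, hK⟩ := exists_ulp_eq_two_zpow (p := p) (emin := emin) (g + Q)
    refine ⟨k, hk, ?_, ?_, ?_⟩
    · obtain ⟨K, hK'⟩ := exists_fl_eq_int_mul_ulp hp1 hfl (g + Q)
      exact ⟨K, by rw [h1, hK', hK]⟩
    · rw [h2, ← hK]; linarith [abs_sub_fl_le_half_ulp hp1 hfl (g + Q)]
    · have hgQ : |g| - |Q| ≤ |g + Q| := by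
        have := abs_sub_abs_le_abs_sub g (-Q)
        rwa [abs_neg, sub_neg_eq_add] at this
      have hg2 : (2 : ℚ) ^ (emin + p - 1) * 2 ≤ |g| := by
        rw [← zpow_add_one₀ two_ne_zero, show emin + p - 1 + 1 = emin + (p : ℤ) by ring]
        exact hgbig
      have hn' : (2 : ℚ) ^ (emin + p - 1) ≤ |g| := by
        linarith [zpow_pos (by norm_num : (0 : ℚ) < 2) (emin + p - 1)]
      have hUg : ulp p emin g * 2 ^ (p - 1) ≤ |g| :=
        (le_div_iff₀ (by positivity)).mp (ulp_le_of_normal hp1 hn')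
      have hP2 : (2 : ℚ) ≤ 2 ^ (p - 1) :=
        calc (2 : ℚ) = 2 ^ 1 := by norm_num
          _ ≤ 2 ^ (p - 1) := pow_le_pow_right₀ (by norm_num) (by omega)
      have hn : (2 : ℚ) ^ (emin + p - 1) ≤ |g + Q| := by
        nlinarith [ulp_pos (p := p) (emin := emin) g]
      have hU : ulp p emin (g + Q) * 2 ^ (p - 1) ≤ |g + Q| :=
        (le_div_iff₀ (by positivity)).mp (ulp_le_of_normal hp1 hn)
      have hf : IsFloat p emin (ulp p emin (g + Q) * 2 ^ (p - 1)) := by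
        rw [hK, ← zpow_natCast, ← zpow_add₀ two_ne_zero]
        exact ⟨1, k + ((p - 1 : ℕ) : ℤ),
          by rw [abs_one]; exact_mod_cast Nat.one_lt_two_pow (by omega), by omega, by simp⟩
      have hpos : 0 < ulp p emin (g + Q) * 2 ^ (p - 1) := by
        have := ulp_pos (p := p) (emin := emin) (g + Q); positivity
      have key := abs_le_abs_fl hfl hf (t := g + Q) (by rw [abs_of_pos hpos]; exact hU)
      rw [abs_of_pos hpos, hK] at key
      rw [h1]; exact key
  refine ⟨?_, List.isChain_cons.mpr ⟨fun r hr => ?_, ainv.low⟩, ?_, ?_⟩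
  · refine ainv.win.cons fun b c t hrs => ?_
    by_cases hbc : Below 2 c b
    · exact Or.inl hbc
    · exact Or.inr (hconv b (by rw [hrs]; rfl) (ainv.flag b c t hrs hbc))
  · obtain ⟨u, hu, huQ, hr2, hQbig⟩ := ainv.hd r hr
    exact lowOneBit_of_onGrid
      (onGrid_upStep hp1 hfl hg hQg hu huQ (two_zpow_le_of_normal hQbig)).2 hr2
  · intro r hr
    simp only [List.head?_cons, Option.mem_def, Option.some.injEq] at hr
    subst hr
    exact hhd
  · intro r₁ r₀ t heq hadj
    simp only [List.cons.injEq] at heq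
    obtain ⟨rfl, hrs⟩ := heq
    obtain ⟨u, hu, huQ, hr, hQbig⟩ := ainv.hd r₀ (by rw [hrs]; rfl)
    exact below_two_emit_of_adjacent hp hfl hu huQ hr hQbig inv.hQ hg hgbig hQg hq hadj

end Summit.Ventures.CertifiedArithmetic.Expansions
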